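import Literature.NumberTheory.Automorphic.RamakrishnanTensorProductGL2Proofs
import Literature.NumberTheory.Automorphic.RamakrishnanTheoremMProofs
import Literature.NumberTheory.Automorphic.PairLFunctionPolesRepData
import Literature.NumberTheory.Automorphic.AutomorphicTwistHecke
import Literature.NumberTheory.Automorphic.IdeleNormDetGL
import Literature.NumberTheory.Automorphic.SatakeParamNeZeroProofs
import Literature.NumberTheory.Automorphic.CuspidalDescentDetCubicRepData
import Literature.NumberTheory.Automorphic.AdelicGroupDataAutomorphicMeasureProofs
import Literature.NumberTheory.Automorphic.RamakrishnanBoxTimesProofs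
import Literature.NumberTheory.Automorphic.PairLFunctionPolesRankNeLandau
import Literature.NumberTheory.Automorphic.AsaiSign
import HarnessLib

/-!
# Ramakrishnan (2000), Lemma 4.1.4: `π ⊠ π'` is not cuspidal when `Ad(π) ≅ Ad(π')` —
# the printed proof mapped onto Jacquet–Shalika (2.1)–(2.3) and Gelbart–Jacquet (proved reductions)

Topic `NumberTheory/Automorphic`; namespace `Literature.NumberTheory.Automorphic`. Second proof file
(theorems only: no definition, no named fact, no `sorry`) towards the discharge
`Ramakrishnan2000_multiplicityOneSL2_holds` of the named fact `Ramakrishnan2000_multiplicityOneSL2`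
(D. Ramakrishnan, *Modularity of the Rankin–Selberg `L`-series, and multiplicity one for `SL(2)`*,
Ann. of Math. 152 (2000), 45–111, Thm. 4.1.2), sibling of `RamakrishnanTensorProductGL2Proofs`,
whose assembly `Ramakrishnan2000_multiplicityOneSL2.of_theoremM` reduced the fact to
(a) `Ramakrishnan2000_theoremM`, (b) **Lemma 4.1.4** ("`π ⊠ π'` is not cuspidal" for non-dihedral
`π, π'` with `Ad(π) ≅ Ad(π')`, in the tree's rendering: no cuspidal `Π` on `GL(4)/F` has the Satake
parameters `{αᵢ βⱼ}` a.e.) and (c) the both-dihedral case. This file proves (b) from the tree's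
named facts for its printed ingredients.

## The printed proof of Lemma 4.1.4 (op. cit. §4.1, p. 39 of the preprint) and its rendering

"LEMMA 4.1.4. `Π` is not cuspidal. *Proof.* … Suppose `Π` is cuspidal. Then, by [JS2], we know that
the Rankin-Selberg L-function `L^S(s, Π × Π^∨)` must have a *simple pole* at `s = 1`. On the other
hand, at any finite place `v` … as `σ_v ⊗ σ_v^∨ ≃ Ad(σ_v) ⊕ 1`,
`(σ_v ⊗ σ'_v) ⊗ (σ_v ⊗ σ'_v)^∨ ≃ 1 ⊕ Ad(σ_v) ⊕ Ad(σ'_v) ⊕ Ad(σ_v) ⊗ Ad(σ'_v)` … this translates to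
`(Id) L^S(s, Π × Π^∨) = ζ_F^S(s) L^S(s, Ad(π)) L^S(s, Ad(π')) L^S(s, Ad(π) × Ad(π'))`. But we know that
`Ad(π)` is isomorphic to `Ad(π')`. Moreover … `Ad(π)^∨ ≃ Ad(π)` … Consequently,
`L^S(s, Ad(π) × Ad(π'))` has a pole at `s = 1`. Also, since `π` and `π'` are non-dihedral,
`L^S(s, Ad(π))` and `L^S(s, Ad(π'))` are entire (cf. [GJ]). Then the identity (Id) implies that
`L^S(s, Π × Π^∨)` has at least a double pole at `s = 1`, leading to the desired contradiction."
(The non-vanishing of `L^S(s, Ad(π))` at `s = 1`, used implicitly in the last step, is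
Jacquet–Shalika's (2.2) = Arthur–Clozel, Ch. 3, (2.2): "it does not vanish there".)

In the Borel–Jacquet model (`CuspidalAutomorphicRepData`, Satake parameters `HasSatakeParamAt`), with
`(LL)` rendered as `t_{π',v} = c_v t_{π,v}` a.e. (hypothesis of `Ramakrishnan2000_multiplicityOneSL2`):

* `A = Ad(π)` is the cuspidal datum on `GL(3)` with `t_A = Ad(t_π) = {a/b, 1, b/a}` of
  `GelbartJacquet_adjoint_lift` (named fact), available because `π` is not dihedral
  (`not_isQuadraticSelfTwistAE_of_not_isSatakeSelfTwist`); `Ad(t_{π'}) = Ad(c_v t_π) = Ad(t_π)`, so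
  one datum serves for both adjoints; `t_A` is self-dual of determinant `1`
  (`adParams_map_inv_of_card_eq_two`, `prod_adParams_of_card_eq_two`).
* *Unitarity.* [JS2] = Arthur–Clozel (2.1)–(2.3) are vendored for Borel–Jacquet data with **unitary**
  Satake families (`|det t_v| = 1`; `JacquetShalika1981_multipliable_partialPairL_repData`,
  `…_partialPairL_boundary_repData`, `…_partialPairL_pole_repData`, named facts of
  `PairLFunctionPolesRepData`), whereas the data of the tree — and a hypothetical cuspidal `Π` with
  `t_Π = t_π ⊗ t_{π'}` — have arbitrary central characters. As in print ("unitary … by convention",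
  op. cit. §2.2; Borel–Jacquet 1979, 5.7) one twists: with `ω = ω_π`, `ω' = ω_{π'}` (as Hecke
  characters with `ω(ϖ_v) = det t_{π,v}` a.e. — a **hypothesis** here, supplied from the Borel–Jacquet
  dictionary by `exists_heckeCharacter_prod_satake_of_sSup_irreducible` in the `_of_sSup_irreducible`
  form), `|ω| = ‖·‖^σ`, `|ω'| = ‖·‖^{σ'}` (`HeckeCharacter.exists_norm_apply_eq_ideleNorm_rpow`) and
  `ν = ‖·‖^{-(σ+σ')/2}` (`exists_heckeCharacter_ideleNorm_cpow`), the twists `P₁ = Π ⊗ ν` and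
  `P₂ = Π ⊗ ν⁻¹ ω⁻¹ ω'⁻¹` (`CuspidalAutomorphicRepData.exists_twist_hecke_hasSatakeParamAt`) are cuspidal
  with unitary Satake families, and `t_{P₂} = t_{P₁}⁻¹` (`map_inv_twist_satakeTensor_pair`: on `GL(2)`,
  `t⁻¹ = (det t)⁻¹ t`), i.e. `P₂` carries the Satake parameters of `P₁^∨ = P̄₁` — the pair to which (2.3)
  applies at `s₀ = 1`.
* `(Id)` is an identity of multisets of pair parameters (`satakeTensor_twist_pair_self_inv`):
  `(t_π ⊗ t_{π'}) ⊗ (t_π ⊗ t_{π'})⁻¹ = (t_π ⊗ t_π⁻¹) ⊗ (t_{π'} ⊗ t_{π'}⁻¹)` (interchange,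
  `satakeTensor_satakeTensor_comm`), the scalars `c_v`, `ν(ϖ_v)` cancel
  (`satakeTensor_map_mul_self_inv`), and `t ⊗ t⁻¹ = {1} + Ad(t)` on `GL(2)`
  (`satakeTensor_self_inv_of_card_eq_two`, "`π ⊠ π̄ ≃ 1 ⊞ Ad(π)`"); hence
  `det(1 - t_{P₁} ⊗ t_{P₂} T) = det(1 - T) det(1 - t_A T)² det(1 - t_A ⊗ t_A T)`
  (`satakePairPolynomial_twist_pair_self_inv`) and, the three Euler products on the right being
  multipliable on `Re s > 1` ((2.1)), `L^S(s, P₁ × P₂) = ζ_F^S(s) L^S(s, A)² L^S(s, A × A)`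
  (`partialPairL_eq_mul_of_satakePairPolynomial_eq`), `ζ_F^S = L^S(s, 𝟙 × 𝟙)` for the trivial
  character as a cuspidal datum on `GL(1)` (`exists_cuspidal_glOne_hasSatakeParamAt_one`).
* The poles: (2.3) for `(𝟙, 𝟙)` and `(A, A)` (`A` self-dual) give `(s-1) ζ_F^S → c₁ ≠ 0`,
  `(s-1) L^S(s, A × A) → c₃ ≠ 0`; (2.2) for `(A, 𝟙)` (`3 ≠ 1`, `X = ∅`) gives `L^S(s, A) → c₂ ≠ 0`; (2.3)
  for `(P₁, P₂)` gives a *finite* limit of `(s-1) L^S(s, P₁ × P₂)` — impossible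
  (`not_tendsto_sub_one_mul_of_double_pole`). This is `Ramakrishnan2000_lemma414_core` (the seven
  instances of the facts, over the union `S` of their exceptional sets) and
  `Ramakrishnan2000_lemma414_of_JS`.

## Main statements

* `Ramakrishnan2000_lemma414_of_JS` — Lemma 4.1.4 in the rendering of
  `Ramakrishnan2000_multiplicityOneSL2.of_theoremM`, from the three Jacquet–Shalika facts, the
  Gelbart–Jacquet lift and the central characters of `π`, `π'`; `…_of_sSup_irreducible` — the same with
  the central characters from the Borel–Jacquet dictionary leaves.
* `Ramakrishnan2000_theoremM_onlyIf_of_JS` — the "only if" half (R2) of the cuspidality criterion of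
  Theorem M for non-dihedral `π` (a twist is a special case of `(LL)`), cf.
  `Ramakrishnan2000_theoremM.of_boxTimes_cuspidal`.
* `Ramakrishnan2000_multiplicityOneSL2.of_theoremM_of_JS` (`…_of_leaves`) — **what now separates
  `Ramakrishnan2000_multiplicityOneSL2_holds` from the tree**: `Ramakrishnan2000_theoremM`, the
  Jacquet–Shalika facts (2.1)–(2.3) for Borel–Jacquet data, `GelbartJacquet_adjoint_lift`, the
  dictionary leaves at rank `2`, and the both-dihedral case of the printed proof (automorphic induction
  from quadratic extensions and op. cit. Prop. 2.3.1 (2), not in the tree).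

## References

* D. Ramakrishnan, *Modularity of the Rankin–Selberg `L`-series, and multiplicity one for `SL(2)`*,
  Ann. of Math. (2) 152 (2000), 45–111, doi:10.2307/2661379; §4.1, Thm. 4.1.2, Lemma 4.1.4 and its
  proof (preprint pp. 37–39), Prop. 3.2.1 (proof), §2.2. [Ramakrishnan2000]
* J. Arthur, L. Clozel, *Simple algebras, base change, and the advanced theory of the trace formula*,
  Ann. of Math. Stud. 120 (1989), Ch. 3 §2, (2.1)–(2.3), p. 171. [ArthurClozelAMS120]
* H. Jacquet, J. A. Shalika, *On Euler products and the classification of automorphic forms II*,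
  Amer. J. Math. 103 (1981), 777–815, Prop. 3.6. [JacquetShalikaAJM1981II]
* S. Gelbart, H. Jacquet, *A relation between automorphic representations of GL(2) and GL(3)*,
  Ann. Sci. ÉNS 11 (1978), Thm. (9.3). [GelbartJacquet1978]
* A. Borel, H. Jacquet, *Automorphic forms and automorphic representations*, Proc. Sympos. Pure Math.
  33 (1979), part 1, §4.6, 5.7. [BorelJacquetCorvallis1979]
-/

noncomputable section

open scoped MatrixGroups Topology Classical
open NumberField IsDedekindDomain MeasureTheory Filter Polynomial

namespace Literature.NumberTheory.Automorphic

open AdelicGroupData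
open Literature.NumberTheory.GaloisRepresentations (HeckeCharacter ideleGroup localUnits)

/-! ### Multiset algebra of pair parameters -/

section Algebra

/-- `satakeTensor α 0 = 0`. [folklore] -/
@[simp]
theorem satakeTensor_zero_right (α : Multiset ℂ) : satakeTensor α 0 = 0 := by
  simp [satakeTensor]

/-- `{1} ⊗ β = β`. [folklore] -/
@[simp]
theorem satakeTensor_singleton_one_left (β : Multiset ℂ) : satakeTensor {1} β = β := by
  rw [satakeTensor_singleton_left]
  simp

/-- `α ⊗ {1} = α`. [folklore] -/
@[simp]
theorem satakeTensor_singleton_one_right (α : Multiset ℂ) : satakeTensor α {1} = α := by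
  rw [satakeTensor_comm]
  exact satakeTensor_singleton_one_left α

/-- `(α ⊗ β)⁻¹ = α⁻¹ ⊗ β⁻¹` entrywise (the contragredient of a pair). [folklore] -/
theorem map_inv_satakeTensor (α β : Multiset ℂ) :
    (satakeTensor α β).map (·⁻¹) = satakeTensor (α.map (·⁻¹)) (β.map (·⁻¹)) := by
  induction α using Multiset.induction_on with
  | empty => simp
  | cons a α ih =>
    rw [satakeTensor_cons_left, Multiset.map_cons, satakeTensor_cons_left, Multiset.map_add, ih,
      Multiset.map_map, Multiset.map_map]
    congr 1
    exact Multiset.map_congr rfl fun x _ => by simp only [Function.comp_apply]; ring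

/-- `β ⊗ (γ ⊗ δ) = γ ⊗ (β ⊗ δ)` as multisets. [folklore] -/
theorem satakeTensor_left_comm (β γ δ : Multiset ℂ) :
    satakeTensor β (satakeTensor γ δ) = satakeTensor γ (satakeTensor β δ) := by
  induction β using Multiset.induction_on with
  | empty => simp
  | cons b β ih =>
    rw [satakeTensor_cons_left, satakeTensor_cons_left, satakeTensor_add_right, ih,
      satakeTensor_map_mul_right]

/-- **Interchange**: `(α ⊗ β) ⊗ (γ ⊗ δ) = (α ⊗ γ) ⊗ (β ⊗ δ)` as multisets — on eigenvalues,
`(t_π ⊗ t_{π'}) ⊗ (t_π ⊗ t_{π'})^∨ = (t_π ⊗ t_π^∨) ⊗ (t_{π'} ⊗ t_{π'}^∨)`, the identity behind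
Ramakrishnan's `(Id)`. [folklore] -/
theorem satakeTensor_satakeTensor_comm (α β γ δ : Multiset ℂ) :
    satakeTensor (satakeTensor α β) (satakeTensor γ δ) =
      satakeTensor (satakeTensor α γ) (satakeTensor β δ) := by
  induction α using Multiset.induction_on with
  | empty => simp
  | cons a α ih =>
    rw [satakeTensor_cons_left, satakeTensor_cons_left, satakeTensor_add_left,
      satakeTensor_add_left, ih, satakeTensor_map_mul_left, satakeTensor_map_mul_left,
      satakeTensor_left_comm]

/-- Scalars cancel in `t ⊗ t^∨`: `(z t) ⊗ (z t)⁻¹ = t ⊗ t⁻¹` for `z ≠ 0`. [folklore] -/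
theorem satakeTensor_map_mul_self_inv {z : ℂ} (hz : z ≠ 0) (m : Multiset ℂ) :
    satakeTensor (m.map (z * ·)) ((m.map (z * ·)).map (·⁻¹)) = satakeTensor m (m.map (·⁻¹)) := by
  have e : (m.map (z * ·)).map (·⁻¹) = (m.map (·⁻¹)).map (z⁻¹ * ·) := by
    rw [Multiset.map_map, Multiset.map_map]
    exact Multiset.map_congr rfl fun x _ => by simp only [Function.comp_apply]; ring
  rw [e, satakeTensor_map_mul_map_mul, mul_inv_cancel₀ hz]
  simp

/-! #### Two-element multisets (Satake parameters on `GL(2)`) -/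

/-- For `t = {a, b}` with `a b ≠ 0`: `t ⊗ t⁻¹ = {1, a/b, b/a, 1} = {1} + Ad(t)`, i.e.
`π ⊗ π^∨ = 1 ⊞ Ad(π)` on Satake parameters (Ramakrishnan 2000, §4.1, proof of Thm. 4.1.2:
"`π ⊠ π̄ ≃ 1 ⊞ Ad(π)`"). [cite: Ramakrishnan2000, §4.1] -/
theorem satakeTensor_self_inv_of_card_eq_two {α : Multiset ℂ} (h2 : Multiset.card α = 2)
    (h0 : (0 : ℂ) ∉ α) : satakeTensor α (α.map (·⁻¹)) = {1} + adParams α := by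
  obtain ⟨a, b, rfl⟩ := Multiset.card_eq_two.mp h2
  have ha : a ≠ 0 := fun h => h0 (by simp [h])
  have hb : b ≠ 0 := fun h => h0 (by simp [h])
  rw [adParams_pair ha hb]
  simp only [Multiset.insert_eq_cons, Multiset.map_cons, Multiset.map_singleton, satakeTensor_cons_left,
    satakeTensor_singleton_left, mul_inv_cancel₀ ha, mul_inv_cancel₀ hb, Multiset.cons_add,
    Multiset.singleton_add]

/-- For `t = {a, b}` with `a b ≠ 0`: `t⁻¹ = (det t)⁻¹ · t` as multisets (`{a⁻¹, b⁻¹} = (ab)⁻¹ {b, a}`):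
on `GL(2)`, `π^∨ ≃ π ⊗ ω_π⁻¹` on Satake parameters. [folklore] -/
theorem map_inv_eq_map_mul_of_card_eq_two {α : Multiset ℂ} (h2 : Multiset.card α = 2)
    (h0 : (0 : ℂ) ∉ α) : α.map (·⁻¹) = α.map ((α.prod)⁻¹ * ·) := by
  obtain ⟨a, b, rfl⟩ := Multiset.card_eq_two.mp h2
  have ha : a ≠ 0 := fun h => h0 (by simp [h])
  have hb : b ≠ 0 := fun h => h0 (by simp [h])
  have e1 : (a * b)⁻¹ * a = b⁻¹ := by field_simp
  have e2 : (a * b)⁻¹ * b = a⁻¹ := by field_simp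
  simp only [Multiset.insert_eq_cons, Multiset.prod_cons, Multiset.prod_singleton, Multiset.map_cons,
    Multiset.map_singleton, e1, e2]
  exact Multiset.pair_comm _ _

/-- `Ad(t)` is self-dual: `Ad(t)⁻¹ = Ad(t)` for `t = {a, b}`, `a b ≠ 0`. [folklore] -/
theorem adParams_map_inv_of_card_eq_two {α : Multiset ℂ} (h2 : Multiset.card α = 2)
    (h0 : (0 : ℂ) ∉ α) : (adParams α).map (·⁻¹) = adParams α := by
  obtain ⟨a, b, rfl⟩ := Multiset.card_eq_two.mp h2
  have ha : a ≠ 0 := fun h => h0 (by simp [h])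
  have hb : b ≠ 0 := fun h => h0 (by simp [h])
  rw [adParams_pair ha hb]
  simp only [Multiset.insert_eq_cons, Multiset.map_cons, Multiset.map_singleton, mul_inv, inv_inv,
    inv_one]
  rw [Multiset.cons_swap]
  congr 1 <;> [ring; (congr 1; ring)]

/-- `det Ad(t) = 1` for `t = {a, b}`, `a b ≠ 0`. [folklore] -/
theorem prod_adParams_of_card_eq_two {α : Multiset ℂ} (h2 : Multiset.card α = 2)
    (h0 : (0 : ℂ) ∉ α) : (adParams α).prod = 1 := by
  obtain ⟨a, b, rfl⟩ := Multiset.card_eq_two.mp h2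
  have ha : a ≠ 0 := fun h => h0 (by simp [h])
  have hb : b ≠ 0 := fun h => h0 (by simp [h])
  rw [adParams_pair ha hb]
  simp only [Multiset.insert_eq_cons, Multiset.prod_cons, Multiset.prod_singleton]
  field_simp

/-- A two-element multiset without `0` has non-zero product. [folklore] -/
theorem prod_ne_zero_of_zero_not_mem {α : Multiset ℂ} (h0 : (0 : ℂ) ∉ α) : α.prod ≠ 0 :=
  Multiset.prod_ne_zero h0

/-- Scaling a multiset by `c ≠ 0` keeps `0` out. [folklore] -/
theorem zero_not_mem_map_mul {α : Multiset ℂ} (h0 : (0 : ℂ) ∉ α) {c : ℂ} (hc : c ≠ 0) :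
    (0 : ℂ) ∉ α.map (c * ·) := by
  intro h
  obtain ⟨x, hx, hx0⟩ := Multiset.mem_map.mp h
  rcases mul_eq_zero.mp hx0 with h1 | h1
  · exact hc h1
  · exact h0 (h1 ▸ hx)

/-! #### Ramakrishnan's identity `(Id)` on Satake parameters -/

/-- **`(Id)` on eigenvalues.** For `t = {a, b}` (`a b ≠ 0`), `c ≠ 0`, `z ≠ 0` and
`p = z · (t ⊗ c t)` (the Satake parameter of a unitary twist of `π ⊠ π'` at a place where
`t_{π'} = c t_π`): `p ⊗ p⁻¹ = ({1} ⊗ {1} + {1} ⊗ Ad t) + (Ad t ⊗ {1} + Ad t ⊗ Ad t)` — Ramakrishnan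
2000, §4.1, proof of Lemma 4.1.4, `(Id)`: `L(s, (π ⊠ π') × (π̄ ⊠ π̄')) = ζ_F(s) L(s, Ad π) L(s, Ad π')
L(s, Ad π × Ad π')` factor by factor, with `Ad π' = Ad π`. [cite: Ramakrishnan2000, §4.1, Lemma 4.1.4] -/
theorem satakeTensor_twist_pair_self_inv {α : Multiset ℂ} (h2 : Multiset.card α = 2)
    (h0 : (0 : ℂ) ∉ α) {c z : ℂ} (hc : c ≠ 0) (hz : z ≠ 0) :
    satakeTensor ((satakeTensor α (α.map (c * ·))).map (z * ·))
        (((satakeTensor α (α.map (c * ·))).map (z * ·)).map (·⁻¹)) =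
      (satakeTensor {1} {1} + satakeTensor {1} (adParams α)) +
        (satakeTensor (adParams α) {1} + satakeTensor (adParams α) (adParams α)) := by
  rw [satakeTensor_map_mul_self_inv hz, map_inv_satakeTensor, satakeTensor_satakeTensor_comm,
    satakeTensor_map_mul_self_inv hc, satakeTensor_self_inv_of_card_eq_two h2 h0,
    satakeTensor_add_left, satakeTensor_add_right, satakeTensor_add_right]

/-- **`(Id)` for the unramified Rankin–Selberg polynomials**: with `p` as above,
`det(1 - p ⊗ p⁻¹ T) = det(1 - T) · det(1 - Ad t T)² · det(1 - Ad t ⊗ Ad t T)`.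
[cite: Ramakrishnan2000, §4.1, Lemma 4.1.4] -/
theorem satakePairPolynomial_twist_pair_self_inv {α : Multiset ℂ} (h2 : Multiset.card α = 2)
    (h0 : (0 : ℂ) ∉ α) {c z : ℂ} (hc : c ≠ 0) (hz : z ≠ 0) :
    satakePairPolynomial ((satakeTensor α (α.map (c * ·))).map (z * ·))
        (((satakeTensor α (α.map (c * ·))).map (z * ·)).map (·⁻¹)) =
      satakePairPolynomial {1} {1} * satakePairPolynomial (adParams α) {1} *
        (satakePairPolynomial (adParams α) {1} * satakePairPolynomial (adParams α) (adParams α)) := by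
  rw [satakePairPolynomial_eq_eulerPolynomial, satakeTensor_twist_pair_self_inv h2 h0 hc hz,
    eulerPolynomial_add, eulerPolynomial_add, eulerPolynomial_add,
    ← satakePairPolynomial_eq_eulerPolynomial, ← satakePairPolynomial_eq_eulerPolynomial,
    ← satakePairPolynomial_eq_eulerPolynomial, ← satakePairPolynomial_eq_eulerPolynomial,
    satakePairPolynomial_comm {1} (adParams α)]

/-- **The contragredient twist.** For `t, t'` two-element multisets without `0` and scalars with
`λ = ν⁻¹ (det t · det t')⁻¹`: `(λ (t ⊗ t'))⁻¹ = ν (t ⊗ t')` entrywise — on `GL(4)`,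
`(Π ⊗ ν⁻¹ ω⁻¹ ω'⁻¹)^∨` and `Π ⊗ ν` have the same Satake parameters when `t_Π = t_π ⊗ t_{π'}`,
`ω = ω_π`, `ω' = ω_{π'}`. [folklore] -/
theorem map_inv_twist_satakeTensor_pair {α β : Multiset ℂ} (hα2 : Multiset.card α = 2)
    (hα0 : (0 : ℂ) ∉ α) (hβ2 : Multiset.card β = 2) (hβ0 : (0 : ℂ) ∉ β) {ν lam pα pβ : ℂ}
    (hpα : pα = α.prod) (hpβ : pβ = β.prod) (hlam : lam = ν⁻¹ * (pα * pβ)⁻¹) :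
    ((satakeTensor α β).map (lam * ·)).map (·⁻¹) = (satakeTensor α β).map (ν * ·) := by
  have hpα0 : pα ≠ 0 := hpα ▸ prod_ne_zero_of_zero_not_mem hα0
  have hpβ0 : pβ ≠ 0 := hpβ ▸ prod_ne_zero_of_zero_not_mem hβ0
  have e1 : ((satakeTensor α β).map (lam * ·)).map (·⁻¹) =
      ((satakeTensor α β).map (·⁻¹)).map (lam⁻¹ * ·) := by
    rw [Multiset.map_map, Multiset.map_map]
    exact Multiset.map_congr rfl fun x _ => by simp only [Function.comp_apply]; ring
  rw [e1, map_inv_satakeTensor, map_inv_eq_map_mul_of_card_eq_two hα2 hα0,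
    map_inv_eq_map_mul_of_card_eq_two hβ2 hβ0, satakeTensor_map_mul_map_mul, Multiset.map_map]
  refine Multiset.map_congr rfl fun x _ => ?_
  simp only [Function.comp_apply, ← hpα, ← hpβ, hlam]
  field_simp

end Algebra

/-! ### The analytic core: a simple pole cannot absorb two -/

section Analytic

/-- **Pole bookkeeping of Lemma 4.1.4.** Along a non-trivial filter `l` with `s - 1 → 0`: if
`L = Z · F · (F · G)` eventually, `(s - 1) Z → c₁ ≠ 0`, `F → c₂ ≠ 0` and `(s - 1) G → c₃ ≠ 0`, then
`(s - 1) L` has no finite limit — "Then the identity (Id) implies that `L^S(s, Π × Π^∨)` has at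
least a double pole at `s = 1`, leading to the desired contradiction" (Ramakrishnan 2000, proof of
Lemma 4.1.4). [cite: Ramakrishnan2000, §4.1, Lemma 4.1.4] -/
theorem not_tendsto_sub_one_mul_of_double_pole {l : Filter ℂ} [l.NeBot] {L Z F G : ℂ → ℂ}
    {c₁ c₂ c₃ : ℂ} (hsub : Tendsto (fun s => s - 1) l (𝓝 0))
    (hL : ∀ᶠ s in l, L s = Z s * F s * (F s * G s))
    (hZ : Tendsto (fun s => (s - 1) * Z s) l (𝓝 c₁)) (hc₁ : c₁ ≠ 0)
    (hF : Tendsto F l (𝓝 c₂)) (hc₂ : c₂ ≠ 0)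
    (hG : Tendsto (fun s => (s - 1) * G s) l (𝓝 c₃)) (hc₃ : c₃ ≠ 0) (c₄ : ℂ) :
    ¬ Tendsto (fun s => (s - 1) * L s) l (𝓝 c₄) := by
  intro h4
  have h1 : Tendsto (fun s => (s - 1) * ((s - 1) * L s)) l (𝓝 (0 * c₄)) := hsub.mul h4
  have h2 : Tendsto (fun s => (s - 1) * Z s * F s * (F s * ((s - 1) * G s))) l
      (𝓝 (c₁ * c₂ * (c₂ * c₃))) := (hZ.mul hF).mul (hF.mul hG)
  have heq : (fun s => (s - 1) * Z s * F s * (F s * ((s - 1) * G s))) =ᶠ[l]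
      fun s => (s - 1) * ((s - 1) * L s) :=
    hL.mono fun s hs => by simp only [hs]; ring
  rw [zero_mul] at h1
  have h := tendsto_nhds_unique (h2.congr' heq) h1
  exact mul_ne_zero (mul_ne_zero hc₁ hc₂) (mul_ne_zero hc₂ hc₃) h

variable {K : Type} [Field K] [NumberField K]

/-- **`(Id)` for partial `L`-functions.** If off `S` the Rankin–Selberg polynomial of `(p, q)`
factors as `P(o,o) · P(a,o) · (P(a,o) · P(a,a))` and the three Euler products on the right are
multipliable at `s`, then `L^S(s, p ⊗ q) = L^S(s, o ⊗ o) L^S(s, a ⊗ o) (L^S(s, a ⊗ o) L^S(s, a ⊗ a))`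
(Ramakrishnan 2000, `(Id)`: `L(s, (π ⊠ π') × (π̄ ⊠ π̄')) = ζ_F(s) L(s, Ad π) L(s, Ad π') L(s, Ad π × Ad π')`).
[cite: Ramakrishnan2000, §4.1, Lemma 4.1.4] -/
theorem partialPairL_eq_mul_of_satakePairPolynomial_eq {S : Set (HeightOneSpectrum (𝓞 K))}
    {p q a o : SatakeFamily K}
    (hId : ∀ v ∉ S, satakePairPolynomial (p v) (q v) =
      satakePairPolynomial (o v) (o v) * satakePairPolynomial (a v) (o v) *
        (satakePairPolynomial (a v) (o v) * satakePairPolynomial (a v) (a v)))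
    {s : ℂ}
    (hoo : Multipliable fun v : {v : HeightOneSpectrum (𝓞 K) // v ∉ S} =>
      ((satakePairPolynomial (o v.1) (o v.1)).eval ((v.1.residueCard : ℂ) ^ (-s)))⁻¹)
    (hao : Multipliable fun v : {v : HeightOneSpectrum (𝓞 K) // v ∉ S} =>
      ((satakePairPolynomial (a v.1) (o v.1)).eval ((v.1.residueCard : ℂ) ^ (-s)))⁻¹)
    (haa : Multipliable fun v : {v : HeightOneSpectrum (𝓞 K) // v ∉ S} =>
      ((satakePairPolynomial (a v.1) (a v.1)).eval ((v.1.residueCard : ℂ) ^ (-s)))⁻¹) :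
    partialPairL S p q s = partialPairL S o o s * partialPairL S a o s *
      (partialPairL S a o s * partialPairL S a a s) := by
  unfold partialPairL
  have hfun : (fun v : {v : HeightOneSpectrum (𝓞 K) // v ∉ S} =>
      ((satakePairPolynomial (p v.1) (q v.1)).eval ((v.1.residueCard : ℂ) ^ (-s)))⁻¹) =
      fun v : {v : HeightOneSpectrum (𝓞 K) // v ∉ S} =>
        ((satakePairPolynomial (o v.1) (o v.1)).eval ((v.1.residueCard : ℂ) ^ (-s)))⁻¹ *
          ((satakePairPolynomial (a v.1) (o v.1)).eval ((v.1.residueCard : ℂ) ^ (-s)))⁻¹ *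
        (((satakePairPolynomial (a v.1) (o v.1)).eval ((v.1.residueCard : ℂ) ^ (-s)))⁻¹ *
          ((satakePairPolynomial (a v.1) (a v.1)).eval ((v.1.residueCard : ℂ) ^ (-s)))⁻¹) := by
    funext v
    rw [hId v.1 v.2, eval_mul, eval_mul, eval_mul, mul_inv, mul_inv, mul_inv]
  rw [hfun, (hoo.mul hao).tprod_mul (hao.mul haa), hoo.tprod_mul hao, hao.tprod_mul haa]

end Analytic

/-! ### The trivial representation of `GL(1)` as a cuspidal datum -/

section GLOne

variable {F : Type} [Field F] [NumberField F]

/-- **The trivial character as a cuspidal datum on `GL(1)`** with Satake parameter `{1}` at almost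
every place: the line `ℂ · 1` over `⊥` (`exists_automorphicRepData_detTwist_glOne` with `θ = 1`; on
`GL(1)` every automorphic form is a cusp form, the parabolic condition being empty), so that
`L^S(s, τ ⊗ τ) = ζ_F^S(s)`. Borel–Jacquet 1979, 4.6. [cite: BorelJacquet1979, 4.6] -/
theorem exists_cuspidal_glOne_hasSatakeParamAt_one (h1 : isCompact_glFiniteIntegralLevel 1 F) :
    ∃ τ : CuspidalAutomorphicRepData 1 F h1,
      ∀ᶠ w : HeightOneSpectrum (𝓞 F) in cofinite, τ.1.HasSatakeParamAt w {1} := by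
  obtain ⟨τ, hW, hW'⟩ := exists_automorphicRepData_detTwist_glOne h1 (1 : HeckeCharacter F)
  have hcusp : τ.W ≤ cuspFormsGL 1 F h1 := by
    rw [hW, Submodule.span_le]
    rintro _ rfl
    exact IsCuspFormGL.mem_cuspFormsGL
      ⟨isAutomorphicForm_detTwist_glOne h1 1, fun k hk hk1 => absurd hk1 (by omega)⟩
  refine ⟨⟨τ, hcusp⟩, ?_⟩
  obtain ⟨𝔪, h𝔪, hθ𝔪⟩ :=
    Literature.NumberTheory.GaloisRepresentations.HeckeCharacter.exists_level_glOne
      (1 : HeckeCharacter F)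
  filter_upwards [(Ideal.finite_factors h𝔪).compl_mem_cofinite] with w hw
  have h := AutomorphicRepData.hasSatakeParamAt_detTwist_glOne h1 hW hW' h𝔪 hθ𝔪 w hw
    (Literature.NumberTheory.GaloisRepresentations.HeckeCharacter.valued_uniformizer (K := F) w)
  simpa only [Literature.NumberTheory.GaloisRepresentations.HeckeCharacter.one_apply,
    Units.val_one] using h

end GLOne

/-! ### Lemma 4.1.4 from Jacquet–Shalika (2.1)–(2.3): the four pairs `(1,1)`, `(A,1)`, `(A,A)`, `(P₁,P₂)` -/

section Core

variable {F : Type} [Field F] [NumberField F]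

/-- `χ(ϖ_v)` is the value of `χ` at the idele `(…, 1, ϖ_v, 1, …)`. [folklore] -/
private theorem vAU_apply (χ : HeckeCharacter F) (v : HeightOneSpectrum (𝓞 F)) :
    χ.valueAtUniformizer v =
      ((χ (localUnits v (GaloisRepresentations.HeckeCharacter.uniformizer F v)) : ℂˣ) : ℂ) := by
  simp only [GaloisRepresentations.HeckeCharacter.valueAtUniformizer,
    GaloisRepresentations.HeckeCharacter.localComponent_apply]

/-- `(χ₁ χ₂)(ϖ_v) = χ₁(ϖ_v) χ₂(ϖ_v)`. [folklore] -/
private theorem vAU_mul (χ₁ χ₂ : HeckeCharacter F) (v : HeightOneSpectrum (𝓞 F)) :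
    (χ₁ * χ₂).valueAtUniformizer v = χ₁.valueAtUniformizer v * χ₂.valueAtUniformizer v := by
  simp only [vAU_apply, GaloisRepresentations.HeckeCharacter.mul_apply, Units.val_mul]

/-- `χ⁻¹(ϖ_v) = χ(ϖ_v)⁻¹`. [folklore] -/
private theorem vAU_inv (χ : HeckeCharacter F) (v : HeightOneSpectrum (𝓞 F)) :
    χ⁻¹.valueAtUniformizer v = (χ.valueAtUniformizer v)⁻¹ := by
  simp only [vAU_apply, GaloisRepresentations.HeckeCharacter.inv_apply, Units.val_inv_eq_inv_val]

/-- `χ(ϖ_v) ≠ 0`. [folklore] -/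
private theorem vAU_ne_zero (χ : HeckeCharacter F) (v : HeightOneSpectrum (𝓞 F)) :
    χ.valueAtUniformizer v ≠ 0 := by
  rw [vAU_apply]
  exact Units.ne_zero _

/-- **Lemma 4.1.4, analytic part, for Borel–Jacquet data** (Ramakrishnan 2000, proof of Lemma 4.1.4:
"Suppose `Π` is cuspidal. Then, by [JS2], we know that the Rankin-Selberg L-function
`L^S(s, Π × Π^∨)` must have a *simple pole* at `s = 1`. … `(Id)` … Consequently,
`L^S(s, Ad(π) × Ad(π'))` has a pole at `s = 1`. Also, since `π` and `π'` are non-dihedral,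
`L^S(s, Ad(π))` and `L^S(s, Ad(π'))` are entire (cf. [GJ]). Then the identity (Id) implies that
`L^S(s, Π × Π^∨)` has at least a double pole at `s = 1`, leading to the desired contradiction";
the non-vanishing of `L^S(s, Ad(π))` at `s = 1`, used implicitly, is Jacquet–Shalika's (2.2)). Granting Jacquet–Shalika
(2.1)–(2.3) for Borel–Jacquet data (`JacquetShalika1981_multipliable_partialPairL_repData`,
`…_partialPairL_boundary_repData`, `…_partialPairL_pole_repData`): there are no cuspidal data `τ` on
`GL(1)`, `A` on `GL(3)` and `P₁, P₂` on `GL(4)` over `F` whose Satake families off a finite `T` are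
`{1}`, a self-dual `Af` of determinant `1`, and unitary `p₁`, `p₂ = p₁⁻¹` with
`det(1 - p₁ ⊗ p₂ T) = det(1 - T) det(1 - Af T)² det(1 - Af ⊗ Af T)` — for then
`L^S(s, P₁ × P₂) = ζ_F^S(s) L^S(s, A)² L^S(s, A × A)` on `Re s > 1` (`S ⊇ T` large) would have a simple
pole at `s = 1` ((2.3) for `(P₁, P₂)`) and a double one ((2.3) for `(τ, τ)` and `(A, A)`, (2.2) for
`(A, τ)`). [cite: Ramakrishnan2000, §4.1, Lemma 4.1.4] [cite: ArthurClozelAMS120, Ch. 3 §2 (2.1)–(2.3)] -/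
theorem Ramakrishnan2000_lemma414_core
    (hJ1 : JacquetShalika1981_multipliable_partialPairL_repData)
    (hJ2 : JacquetShalika1981_partialPairL_boundary_repData)
    (hJ3 : JacquetShalika1981_partialPairL_pole_repData)
    {h1 : isCompact_glFiniteIntegralLevel 1 F} {h3 : isCompact_glFiniteIntegralLevel 3 F}
    {h4 : isCompact_glFiniteIntegralLevel 4 F}
    (τ : CuspidalAutomorphicRepData 1 F h1) (A : CuspidalAutomorphicRepData 3 F h3)
    (P₁ P₂ : CuspidalAutomorphicRepData 4 F h4) (one Af p₁ p₂ : SatakeFamily F)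
    {T : Set (HeightOneSpectrum (𝓞 F))} (hT : T.Finite) (hone : ∀ w, one w = {1})
    (hτ : ∀ w ∉ T, τ.1.HasSatakeParamAt w (one w)) (hA : ∀ w ∉ T, A.1.HasSatakeParamAt w (Af w))
    (hP₁ : ∀ w ∉ T, P₁.1.HasSatakeParamAt w (p₁ w)) (hP₂ : ∀ w ∉ T, P₂.1.HasSatakeParamAt w (p₂ w))
    (huA : ∀ w ∉ T, (Af w).prod = 1) (hXA : ∀ w ∉ T, (Af w).map (·⁻¹) = Af w)
    (hu₁ : ∀ w ∉ T, ‖(p₁ w).prod‖ = 1) (hu₂ : ∀ w ∉ T, ‖(p₂ w).prod‖ = 1)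
    (hX : ∀ w ∉ T, (p₂ w).map (·⁻¹) = p₁ w)
    (hId : ∀ w ∉ T, satakePairPolynomial (p₁ w) (p₂ w) =
      satakePairPolynomial (one w) (one w) * satakePairPolynomial (Af w) (one w) *
        (satakePairPolynomial (Af w) (one w) * satakePairPolynomial (Af w) (Af w))) :
    False := by
  -- the exceptional sets of the seven instances of (2.1)–(2.3)
  obtain ⟨S₁, hS₁, hJ1a⟩ := hJ1 1 1 F h1 h1 one_pos one_pos τ τ
  obtain ⟨S₂, hS₂, hJ1b⟩ := hJ1 3 1 F h3 h1 (by norm_num) one_pos A τ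
  obtain ⟨S₃, hS₃, hJ1c⟩ := hJ1 3 3 F h3 h3 (by norm_num) (by norm_num) A A
  obtain ⟨S₄, hS₄, hJ3a⟩ := hJ3 1 F h1 one_pos τ τ
  obtain ⟨S₅, hS₅, hJ3b⟩ := hJ3 3 F h3 (by norm_num) A A
  obtain ⟨S₆, hS₆, hJ3c⟩ := hJ3 4 F h4 (by norm_num) P₁ P₂
  obtain ⟨S₇, hS₇, hJ2a⟩ := hJ2 3 1 F h3 h1 (by norm_num) one_pos A τ
  set S : Set (HeightOneSpectrum (𝓞 F)) := T ∪ S₁ ∪ S₂ ∪ S₃ ∪ S₄ ∪ S₅ ∪ S₆ ∪ S₇ with hS_def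
  have hS : S.Finite :=
    ((((((hT.union hS₁).union hS₂).union hS₃).union hS₄).union hS₅).union hS₆).union hS₇
  have hTS : ∀ w ∉ S, w ∉ T := fun w hw hwT => hw (by simp [hS_def, hwT])
  have sub₁ : S₁ ⊆ S := fun x hx => by simp [hS_def, hx]
  have sub₂ : S₂ ⊆ S := fun x hx => by simp [hS_def, hx]
  have sub₃ : S₃ ⊆ S := fun x hx => by simp [hS_def, hx]
  have sub₄ : S₄ ⊆ S := fun x hx => by simp [hS_def, hx]
  have sub₅ : S₅ ⊆ S := fun x hx => by simp [hS_def, hx]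
  have sub₆ : S₆ ⊆ S := fun x hx => by simp [hS_def, hx]
  have sub₇ : S₇ ⊆ S := fun x hx => by simp [hS_def, hx]
  -- the hypotheses off `S`
  have hτS : ∀ w ∉ S, τ.1.HasSatakeParamAt w (one w) := fun w hw => hτ w (hTS w hw)
  have hAS : ∀ w ∉ S, A.1.HasSatakeParamAt w (Af w) := fun w hw => hA w (hTS w hw)
  have hP₁S : ∀ w ∉ S, P₁.1.HasSatakeParamAt w (p₁ w) := fun w hw => hP₁ w (hTS w hw)
  have hP₂S : ∀ w ∉ S, P₂.1.HasSatakeParamAt w (p₂ w) := fun w hw => hP₂ w (hTS w hw)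
  have huone : ∀ w ∉ S, ‖(one w).prod‖ = 1 := fun w _ => by rw [hone]; simp
  have huAS : ∀ w ∉ S, ‖(Af w).prod‖ = 1 := fun w hw => by rw [huA w (hTS w hw), norm_one]
  have hu₁S : ∀ w ∉ S, ‖(p₁ w).prod‖ = 1 := fun w hw => hu₁ w (hTS w hw)
  have hu₂S : ∀ w ∉ S, ‖(p₂ w).prod‖ = 1 := fun w hw => hu₂ w (hTS w hw)
  -- the three `X`-conditions at `s₀ = 1`
  have hX11 : ∀ᶠ w : HeightOneSpectrum (𝓞 F) in cofinite,
      (one w).map ((((w.residueCard : ℂ)) ^ ((1 : ℂ) - 1)) * ·) = (one w).map (·⁻¹) :=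
    Filter.Eventually.of_forall fun w => by rw [hone]; simp
  have hXAA : ∀ᶠ w : HeightOneSpectrum (𝓞 F) in cofinite,
      (Af w).map ((((w.residueCard : ℂ)) ^ ((1 : ℂ) - 1)) * ·) = (Af w).map (·⁻¹) := by
    filter_upwards [hT.eventually_cofinite_notMem] with w hw
    rw [sub_self, Complex.cpow_zero, hXA w hw]
    simp
  have hXP : ∀ᶠ w : HeightOneSpectrum (𝓞 F) in cofinite,
      (p₁ w).map ((((w.residueCard : ℂ)) ^ ((1 : ℂ) - 1)) * ·) = (p₂ w).map (·⁻¹) := by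
    filter_upwards [hT.eventually_cofinite_notMem] with w hw
    rw [sub_self, Complex.cpow_zero, hX w hw]
    simp
  -- (2.1): multipliability of the three Euler products on the right of `(Id)`
  have m11 : ∀ s : ℂ, 1 < s.re → Multipliable fun v : {v : HeightOneSpectrum (𝓞 F) // v ∉ S} =>
      ((satakePairPolynomial (one v.1) (one v.1)).eval ((v.1.residueCard : ℂ) ^ (-s)))⁻¹ :=
    fun s hs => hJ1a hS sub₁ hτS hτS huone huone hs
  have mA1 : ∀ s : ℂ, 1 < s.re → Multipliable fun v : {v : HeightOneSpectrum (𝓞 F) // v ∉ S} =>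
      ((satakePairPolynomial (Af v.1) (one v.1)).eval ((v.1.residueCard : ℂ) ^ (-s)))⁻¹ :=
    fun s hs => hJ1b hS sub₂ hAS hτS huAS huone hs
  have mAA : ∀ s : ℂ, 1 < s.re → Multipliable fun v : {v : HeightOneSpectrum (𝓞 F) // v ∉ S} =>
      ((satakePairPolynomial (Af v.1) (Af v.1)).eval ((v.1.residueCard : ℂ) ^ (-s)))⁻¹ :=
    fun s hs => hJ1c hS sub₃ hAS hAS huAS huAS hs
  -- (2.3) for `(τ, τ)`: `(s - 1) ζ_F^S(s) → c₁ ≠ 0`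
  obtain ⟨c₁, hc₁, hZ⟩ := hJ3a hS sub₄ hτS hτS huone huone Complex.one_re hX11
  -- (2.2) for `(A, τ)`: `L^S(s, A) → c₂ ≠ 0` (`3 ≠ 1`, so `X = ∅`)
  obtain ⟨c₂, hc₂, hF⟩ := hJ2a hS sub₇ hAS hτS huAS huone Complex.one_re
    (fun h => absurd h.1 (by norm_num))
  -- (2.3) for `(A, A)`: `(s - 1) L^S(s, A × A) → c₃ ≠ 0` (`A` self-dual)
  obtain ⟨c₃, hc₃, hG⟩ := hJ3b hS sub₅ hAS hAS huAS huAS Complex.one_re hXAA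
  -- (2.3) for `(P₁, P₂)`: `(s - 1) L^S(s, P₁ × P₂)` has a finite limit
  obtain ⟨c₄, -, hL⟩ := hJ3c hS sub₆ hP₁S hP₂S hu₁S hu₂S Complex.one_re hXP
  -- `(Id)` on `Re s > 1` and the double pole
  refine not_tendsto_sub_one_mul_of_double_pole (l := 𝓝[{s : ℂ | 1 < s.re}] 1)
    tendsto_sub_one_nhdsWithin_one_lt_re ?_ hZ hc₁ hF hc₂ hG hc₃ c₄ hL
  refine eventually_nhdsWithin_of_forall fun s hs => ?_
  exact partialPairL_eq_mul_of_satakePairPolynomial_eq (fun v hv => hId v (hTS v hv)) (m11 s hs)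
    (mA1 s hs) (mAA s hs)

end Core

/-! ### Lemma 4.1.4 in the tree's rendering -/

section Lemma414

variable {F : Type} [Field F] [NumberField F]

/-- **Ramakrishnan's Lemma 4.1.4 from Jacquet–Shalika and Gelbart–Jacquet** (op. cit. §4.1:
"LEMMA 4.1.4. `π ⊠ π'` is not cuspidal", for cuspidal non-dihedral `π, π'` on `GL(2)/F` with
`Ad(π) ≃ Ad(π')`), in the rendering of `Ramakrishnan2000_multiplicityOneSL2.of_theoremM`: granting
(2.1)–(2.3) for Borel–Jacquet data and the Gelbart–Jacquet lift, if the cuspidal `π, π'` on `GL(2)/F`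
satisfy `(LL)` (`t_{π',v} = c_v t_{π,v}` a.e.), `π` admits no non-trivial self-twist, and `π`, `π'`
have central characters at the level of Satake parameters (`Ω(ϖ_v) = det t_{π,v}` a.e. — the
unramified shadow of `ω_π`, supplied from the Borel–Jacquet dictionary in
`Ramakrishnan2000_lemma414_of_JS_of_sSup_irreducible`), then **no cuspidal `Π` on `GL(4)/F` has the
Satake parameters `{αᵢ βⱼ}` almost everywhere.** Printed proof, followed here: `A = Ad(π)` is cuspidal
on `GL(3)` ([GJ], `GelbartJacquet_adjoint_lift`, `π` being non-dihedral), self-dual of determinant `1`;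
if `Π` were cuspidal, so are its twists `P₁ = Π ⊗ ν` (`ν = ‖·‖^{-(σ+σ')/2}`, `|ω_π| = ‖·‖^σ`,
`|ω_{π'}| = ‖·‖^{σ'}`, making `P₁` unitary at the unramified places) and `P₂ = Π ⊗ ν⁻¹ ω_π⁻¹ ω_{π'}⁻¹`,
whose Satake parameters are those of `P₁^∨` (`t_{π}⁻¹ = ω_π(ϖ)⁻¹ t_π` on `GL(2)`); by `(Id)`
(`satakePairPolynomial_twist_pair_self_inv`, the scalars `c_v`, `ν(ϖ_v)` cancelling)
`L^S(s, P₁ × P₂) = ζ_F^S(s) L^S(s, A)² L^S(s, A × A)`, and `Ramakrishnan2000_lemma414_core` gives the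
contradiction between the simple pole on the left and the double pole on the right.
[cite: Ramakrishnan2000, §4.1, Lemma 4.1.4] -/
theorem Ramakrishnan2000_lemma414_of_JS
    (hJ1 : JacquetShalika1981_multipliable_partialPairL_repData)
    (hJ2 : JacquetShalika1981_partialPairL_boundary_repData)
    (hJ3 : JacquetShalika1981_partialPairL_pole_repData)
    (hGJ : GelbartJacquet_adjoint_lift)
    {h2 : isCompact_glFiniteIntegralLevel 2 F} {h4 : isCompact_glFiniteIntegralLevel 4 F}
    (π π' : CuspidalAutomorphicRepData 2 F h2)
    (hω : ∃ Ω : HeckeCharacter F, ∀ᶠ v : HeightOneSpectrum (𝓞 F) in cofinite, ∀ α : Multiset ℂ,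
      π.1.HasSatakeParamAt v α → Ω.valueAtUniformizer v = α.prod)
    (hω' : ∃ Ω' : HeckeCharacter F, ∀ᶠ v : HeightOneSpectrum (𝓞 F) in cofinite, ∀ β : Multiset ℂ,
      π'.1.HasSatakeParamAt v β → Ω'.valueAtUniformizer v = β.prod)
    (hLL : ∀ᶠ v : HeightOneSpectrum (𝓞 F) in cofinite, ∃ (α : Multiset ℂ) (c : ℂ), c ≠ 0 ∧
      π.1.HasSatakeParamAt v α ∧ π'.1.HasSatakeParamAt v (α.map (c * ·)))
    (hπ : ¬ IsSatakeSelfTwist π.1) :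
    ¬ ∃ P : CuspidalAutomorphicRepData 4 F h4,
      ∀ᶠ v : HeightOneSpectrum (𝓞 F) in cofinite, ∀ α β : Multiset ℂ,
        π.1.HasSatakeParamAt v α → π'.1.HasSatakeParamAt v β →
          P.1.HasSatakeParamAt v (satakeTensor α β) := by
  rintro ⟨P, hP⟩
  obtain ⟨Ω, hΩ⟩ := hω
  obtain ⟨Ω', hΩ'⟩ := hω'
  have h1 : isCompact_glFiniteIntegralLevel 1 F := isCompact_glFiniteIntegralLevel_holds 1 F
  have h3 : isCompact_glFiniteIntegralLevel 3 F := isCompact_glFiniteIntegralLevel_holds 3 F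
  -- `A = Ad(π)`, cuspidal on `GL(3)` since `π` is not dihedral (Gelbart–Jacquet)
  obtain ⟨A, hA⟩ := hGJ F h2 h3 π
    (fun K _ _ _ hK => not_isQuadraticSelfTwistAE_of_not_isSatakeSelfTwist hπ K hK)
  -- the trivial representation of `GL(1)`
  obtain ⟨τ, hτ⟩ := exists_cuspidal_glOne_hasSatakeParamAt_one h1
  -- exponents of the central characters and the normalising character `ν = ‖·‖^{-(σ+σ')/2}`
  obtain ⟨σ, hσ⟩ := Ω.exists_norm_apply_eq_ideleNorm_rpow
  obtain ⟨σ', hσ'⟩ := Ω'.exists_norm_apply_eq_ideleNorm_rpow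
  obtain ⟨ν, hν⟩ := exists_heckeCharacter_ideleNorm_cpow F ((-((σ + σ') / 2) : ℝ) : ℂ)
  have hνΩ : ∀ x : ideleGroup F,
      ‖((ν x : ℂˣ) : ℂ)‖ ^ 2 * ‖((Ω x : ℂˣ) : ℂ)‖ * ‖((Ω' x : ℂˣ) : ℂ)‖ = 1 := by
    intro x
    have hN : (0 : ℝ) < GaloisRepresentations.ideleNorm x := by
      rw [← coe_ideleNorm]
      exact NNReal.coe_pos.2 (pos_iff_ne_zero.2 (ideleNorm_ne_zero _))
    rw [hν x, Complex.norm_cpow_eq_rpow_re_of_pos hN, Complex.ofReal_re, hσ x, hσ' x,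
      ← Real.rpow_natCast, ← Real.rpow_mul hN.le, ← Real.rpow_add hN, ← Real.rpow_add hN]
    have e : -((σ + σ') / 2) * ((2 : ℕ) : ℝ) + σ + σ' = 0 := by push_cast; ring
    rw [e, Real.rpow_zero]
  -- the unitary twists `P₁ = P ⊗ ν` and `P₂ = P ⊗ ν⁻¹ (Ω Ω')⁻¹` (Satake parameters of `P₁^∨`)
  haveI : NeZero (4 : ℕ) := ⟨by norm_num⟩
  obtain ⟨P₁, hP₁⟩ := CuspidalAutomorphicRepData.exists_twist_hecke_hasSatakeParamAt ν P
  obtain ⟨P₂, hP₂⟩ :=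
    CuspidalAutomorphicRepData.exists_twist_hecke_hasSatakeParamAt (ν⁻¹ * (Ω * Ω')⁻¹) P
  -- Satake families of `π`, `π'`
  obtain ⟨απ, eπ⟩ : ∃ f : SatakeFamily F, ∀ᶠ w : HeightOneSpectrum (𝓞 F) in cofinite,
      π.1.HasSatakeParamAt w (f w) :=
    ⟨fun w => if h : π.1.IsUnramifiedAt w then h.choose else 0, by
      filter_upwards [π.1.hasSatakeParamAt_cofinite_holds] with w hw
      rw [dif_pos hw]
      exact hw.choose_spec⟩
  obtain ⟨απ', eπ'⟩ : ∃ f : SatakeFamily F, ∀ᶠ w : HeightOneSpectrum (𝓞 F) in cofinite,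
      π'.1.HasSatakeParamAt w (f w) :=
    ⟨fun w => if h : π'.1.IsUnramifiedAt w then h.choose else 0, by
      filter_upwards [π'.1.hasSatakeParamAt_cofinite_holds] with w hw
      rw [dif_pos hw]
      exact hw.choose_spec⟩
  -- the good places: all the almost-everywhere statements at once
  have hgood : ∀ᶠ w : HeightOneSpectrum (𝓞 F) in cofinite,
      π.1.HasSatakeParamAt w (απ w) ∧ π'.1.HasSatakeParamAt w (απ' w) ∧
      (∃ c : ℂ, c ≠ 0 ∧ απ' w = (απ w).map (c * ·)) ∧
      A.1.HasSatakeParamAt w (adParams (απ w)) ∧ τ.1.HasSatakeParamAt w {1} ∧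
      P₁.1.HasSatakeParamAt w ((satakeTensor (απ w) (απ' w)).map (ν.valueAtUniformizer w * ·)) ∧
      P₂.1.HasSatakeParamAt w
        ((satakeTensor (απ w) (απ' w)).map ((ν⁻¹ * (Ω * Ω')⁻¹).valueAtUniformizer w * ·)) ∧
      Ω.valueAtUniformizer w = (απ w).prod ∧ Ω'.valueAtUniformizer w = (απ' w).prod := by
    filter_upwards [eπ, eπ', hLL, hA, hτ, hP, hP₁, hP₂, hΩ, hΩ']
      with w h1w h2w hLLw hAw hτw hPw hP₁w hP₂w hΩw hΩ'w
    obtain ⟨α₀, c, hc, hα₀, hα₀'⟩ := hLLw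
    have e1 : απ w = α₀ := π.1.hasSatakeParamAt_unique_holds h1w hα₀
    have e2 : απ' w = α₀.map (c * ·) := π'.1.hasSatakeParamAt_unique_holds h2w hα₀'
    exact ⟨h1w, h2w, ⟨c, hc, by rw [e2, e1]⟩, hAw _ h1w, hτw, hP₁w _ (hPw _ _ h1w h2w),
      hP₂w _ (hPw _ _ h1w h2w), hΩw _ h1w, hΩ'w _ h2w⟩
  obtain ⟨T, hT, hgoodT⟩ : ∃ T : Set (HeightOneSpectrum (𝓞 F)), T.Finite ∧ ∀ w ∉ T,
      π.1.HasSatakeParamAt w (απ w) ∧ π'.1.HasSatakeParamAt w (απ' w) ∧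
      (∃ c : ℂ, c ≠ 0 ∧ απ' w = (απ w).map (c * ·)) ∧
      A.1.HasSatakeParamAt w (adParams (απ w)) ∧ τ.1.HasSatakeParamAt w {1} ∧
      P₁.1.HasSatakeParamAt w ((satakeTensor (απ w) (απ' w)).map (ν.valueAtUniformizer w * ·)) ∧
      P₂.1.HasSatakeParamAt w
        ((satakeTensor (απ w) (απ' w)).map ((ν⁻¹ * (Ω * Ω')⁻¹).valueAtUniformizer w * ·)) ∧
      Ω.valueAtUniformizer w = (απ w).prod ∧ Ω'.valueAtUniformizer w = (απ' w).prod :=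
    ⟨_, Filter.eventually_cofinite.1 hgood, fun w hw => not_not.1 hw⟩
  -- pointwise consequences at a good place
  have card2 : ∀ w ∉ T, Multiset.card (απ w) = 2 := fun w hw => (hgoodT w hw).1.card_eq
  have card2' : ∀ w ∉ T, Multiset.card (απ' w) = 2 := fun w hw => (hgoodT w hw).2.1.card_eq
  have nz : ∀ w ∉ T, (0 : ℂ) ∉ απ w := fun w hw h0 =>
    hasSatakeParamAt_ne_zero_holds (hgoodT w hw).1 0 h0 rfl
  have nz' : ∀ w ∉ T, (0 : ℂ) ∉ απ' w := fun w hw h0 =>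
    hasSatakeParamAt_ne_zero_holds (hgoodT w hw).2.1 0 h0 rfl
  have hX : ∀ w ∉ T,
      ((satakeTensor (απ w) (απ' w)).map ((ν⁻¹ * (Ω * Ω')⁻¹).valueAtUniformizer w * ·)).map (·⁻¹) =
        (satakeTensor (απ w) (απ' w)).map (ν.valueAtUniformizer w * ·) := fun w hw =>
    map_inv_twist_satakeTensor_pair (card2 w hw) (nz w hw) (card2' w hw) (nz' w hw)
      (hgoodT w hw).2.2.2.2.2.2.2.1 (hgoodT w hw).2.2.2.2.2.2.2.2
      (by rw [vAU_mul, vAU_inv, vAU_inv, vAU_mul])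
  have hu₁ : ∀ w ∉ T,
      ‖((satakeTensor (απ w) (απ' w)).map (ν.valueAtUniformizer w * ·)).prod‖ = 1 := by
    intro w hw
    obtain ⟨-, -, -, -, -, -, -, hΩw, hΩ'w⟩ := hgoodT w hw
    rw [prod_map_const_mul_eq, card_satakeTensor, prod_satakeTensor, card2 w hw, card2' w hw,
      ← hΩw, ← hΩ'w, vAU_apply, vAU_apply, vAU_apply, norm_mul, norm_mul, norm_pow, norm_pow,
      norm_pow]
    have key := hνΩ (localUnits w (GaloisRepresentations.HeckeCharacter.uniformizer F w))
    calc ‖((ν (localUnits w (GaloisRepresentations.HeckeCharacter.uniformizer F w)) : ℂˣ) : ℂ)‖ ^ (2 * 2) *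
          (‖((Ω (localUnits w (GaloisRepresentations.HeckeCharacter.uniformizer F w)) : ℂˣ) : ℂ)‖ ^ 2 *
            ‖((Ω' (localUnits w (GaloisRepresentations.HeckeCharacter.uniformizer F w)) : ℂˣ) : ℂ)‖ ^ 2)
          = (‖((ν (localUnits w (GaloisRepresentations.HeckeCharacter.uniformizer F w)) : ℂˣ) : ℂ)‖ ^ 2 *
              ‖((Ω (localUnits w (GaloisRepresentations.HeckeCharacter.uniformizer F w)) : ℂˣ) : ℂ)‖ *
              ‖((Ω' (localUnits w (GaloisRepresentations.HeckeCharacter.uniformizer F w)) : ℂˣ) : ℂ)‖) ^ 2 := by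
            ring
      _ = 1 := by rw [key, one_pow]
  have hu₂ : ∀ w ∉ T,
      ‖((satakeTensor (απ w) (απ' w)).map ((ν⁻¹ * (Ω * Ω')⁻¹).valueAtUniformizer w * ·)).prod‖ = 1 := by
    intro w hw
    have e : (satakeTensor (απ w) (απ' w)).map ((ν⁻¹ * (Ω * Ω')⁻¹).valueAtUniformizer w * ·) =
        ((satakeTensor (απ w) (απ' w)).map (ν.valueAtUniformizer w * ·)).map (·⁻¹) := by
      rw [← hX w hw, Multiset.map_map]
      simp
    rw [e, Multiset.prod_map_inv, Multiset.map_id', norm_inv, hu₁ w hw, inv_one]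
  have hId : ∀ w ∉ T,
      satakePairPolynomial ((satakeTensor (απ w) (απ' w)).map (ν.valueAtUniformizer w * ·))
          ((satakeTensor (απ w) (απ' w)).map ((ν⁻¹ * (Ω * Ω')⁻¹).valueAtUniformizer w * ·)) =
        satakePairPolynomial {1} {1} * satakePairPolynomial (adParams (απ w)) {1} *
          (satakePairPolynomial (adParams (απ w)) {1} *
            satakePairPolynomial (adParams (απ w)) (adParams (απ w))) := by
    intro w hw
    obtain ⟨-, -, ⟨c, hc, hβ⟩, -⟩ := hgoodT w hw
    have e : (satakeTensor (απ w) (απ' w)).map ((ν⁻¹ * (Ω * Ω')⁻¹).valueAtUniformizer w * ·) =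
        ((satakeTensor (απ w) (απ' w)).map (ν.valueAtUniformizer w * ·)).map (·⁻¹) := by
      rw [← hX w hw, Multiset.map_map]
      simp
    rw [e, hβ]
    exact satakePairPolynomial_twist_pair_self_inv (card2 w hw) (nz w hw) hc (vAU_ne_zero ν w)
  exact Ramakrishnan2000_lemma414_core hJ1 hJ2 hJ3 τ A P₁ P₂ (fun _ => {1})
    (fun w => adParams (απ w))
    (fun w => (satakeTensor (απ w) (απ' w)).map (ν.valueAtUniformizer w * ·))
    (fun w => (satakeTensor (απ w) (απ' w)).map ((ν⁻¹ * (Ω * Ω')⁻¹).valueAtUniformizer w * ·))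
    hT (fun _ => rfl) (fun w hw => (hgoodT w hw).2.2.2.2.1) (fun w hw => (hgoodT w hw).2.2.2.1)
    (fun w hw => (hgoodT w hw).2.2.2.2.2.1) (fun w hw => (hgoodT w hw).2.2.2.2.2.2.1)
    (fun w hw => prod_adParams_of_card_eq_two (card2 w hw) (nz w hw))
    (fun w hw => adParams_map_inv_of_card_eq_two (card2 w hw) (nz w hw)) hu₁ hu₂ hX hId

/-- **Lemma 4.1.4 from Jacquet–Shalika, Gelbart–Jacquet and the Borel–Jacquet dictionary.** The
central-character hypotheses of `Ramakrishnan2000_lemma414_of_JS` hold for every cuspidal datum,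
granting the dictionary between Borel–Jacquet data and `L²_cusp` (`AutomorphicRepsGL.exists_isAssociatedL2`,
`hasSatakeParamAt_iff_L2`) and the semisimplicity of the `A_G`-invariant cusp forms
(`AutomorphicRepsGL.stable_cuspidal_eq_sSup_irreducible`) — `exists_heckeCharacter_prod_satake_of_sSup_irreducible`
(`ω_π(ϖ_v) = det t_{π,v}`, Borel–Jacquet 1979, §4.6 and 5.7), with the automorphic measure of
`AdelicGroupData.exists_isAutomorphicMeasure_gl_holds`. These are the leaves to which the tree also
reduces (2.1)–(2.3) for Borel–Jacquet data (`PairLFunctionPolesRepData`).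
[cite: Ramakrishnan2000, §4.1, Lemma 4.1.4] [cite: BorelJacquetCorvallis1979, §4.6 and 5.7] -/
theorem Ramakrishnan2000_lemma414_of_JS_of_sSup_irreducible
    (hJ1 : JacquetShalika1981_multipliable_partialPairL_repData)
    (hJ2 : JacquetShalika1981_partialPairL_boundary_repData)
    (hJ3 : JacquetShalika1981_partialPairL_pole_repData)
    (hGJ : GelbartJacquet_adjoint_lift)
    {h2 : isCompact_glFiniteIntegralLevel 2 F} {h4 : isCompact_glFiniteIntegralLevel 4 F}
    (hAss : ∀ (μ : Measure (gl 2 F).automorphicQuotient) [(gl 2 F).IsAutomorphicMeasure μ],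
      AutomorphicRepsGL.exists_isAssociatedL2 h2 μ)
    (hL2 : ∀ (μ : Measure (gl 2 F).automorphicQuotient) [(gl 2 F).IsAutomorphicMeasure μ],
      hasSatakeParamAt_iff_L2 h2 μ)
    (hss : AutomorphicRepsGL.stable_cuspidal_eq_sSup_irreducible h2)
    (π π' : CuspidalAutomorphicRepData 2 F h2)
    (hLL : ∀ᶠ v : HeightOneSpectrum (𝓞 F) in cofinite, ∃ (α : Multiset ℂ) (c : ℂ), c ≠ 0 ∧
      π.1.HasSatakeParamAt v α ∧ π'.1.HasSatakeParamAt v (α.map (c * ·)))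
    (hπ : ¬ IsSatakeSelfTwist π.1) :
    ¬ ∃ P : CuspidalAutomorphicRepData 4 F h4,
      ∀ᶠ v : HeightOneSpectrum (𝓞 F) in cofinite, ∀ α β : Multiset ℂ,
        π.1.HasSatakeParamAt v α → π'.1.HasSatakeParamAt v β →
          P.1.HasSatakeParamAt v (satakeTensor α β) := by
  obtain ⟨μ, hμ⟩ := AdelicGroupData.exists_isAutomorphicMeasure_gl_holds 2 F
  haveI := hμ
  haveI : NeZero (2 : ℕ) := ⟨two_ne_zero⟩
  exact Ramakrishnan2000_lemma414_of_JS hJ1 hJ2 hJ3 hGJ π π'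
    (exists_heckeCharacter_prod_satake_of_sSup_irreducible (hAss μ) (hL2 μ) hss π)
    (exists_heckeCharacter_prod_satake_of_sSup_irreducible (hAss μ) (hL2 μ) hss π') hLL hπ

/-- **The "only if" half of the cuspidality criterion of Theorem M for non-dihedral `π`, from
Jacquet–Shalika and Gelbart–Jacquet** — hypothesis (R2) of `Ramakrishnan2000_theoremM.of_boxTimes_cuspidal`
in the non-dihedral case (Ramakrishnan 2000, proof of Prop. 3.2.1: "Suppose `π' ≃ π ⊗ χ` … Then
`π ⊠ π'` cannot be cuspidal"): a twist `t_{π',v} = χ(ϖ_v) t_{π,v}` a.e. is a special case of `(LL)`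
(`c_v = χ(ϖ_v) ≠ 0`), so `Ramakrishnan2000_lemma414_of_JS` applies.
[cite: Ramakrishnan2000, Prop. 3.2.1 (proof) and Lemma 4.1.4] -/
theorem Ramakrishnan2000_theoremM_onlyIf_of_JS
    (hJ1 : JacquetShalika1981_multipliable_partialPairL_repData)
    (hJ2 : JacquetShalika1981_partialPairL_boundary_repData)
    (hJ3 : JacquetShalika1981_partialPairL_pole_repData)
    (hGJ : GelbartJacquet_adjoint_lift)
    {h2 : isCompact_glFiniteIntegralLevel 2 F} {h4 : isCompact_glFiniteIntegralLevel 4 F}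
    (π π' : CuspidalAutomorphicRepData 2 F h2)
    (hω : ∃ Ω : HeckeCharacter F, ∀ᶠ v : HeightOneSpectrum (𝓞 F) in cofinite, ∀ α : Multiset ℂ,
      π.1.HasSatakeParamAt v α → Ω.valueAtUniformizer v = α.prod)
    (hω' : ∃ Ω' : HeckeCharacter F, ∀ᶠ v : HeightOneSpectrum (𝓞 F) in cofinite, ∀ β : Multiset ℂ,
      π'.1.HasSatakeParamAt v β → Ω'.valueAtUniformizer v = β.prod)
    (hπ : ¬ IsSatakeSelfTwist π.1) (χ : HeckeCharacter F) (hχ : IsSatakeTwistBy π.1 π'.1 χ) :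
    ¬ ∃ P : CuspidalAutomorphicRepData 4 F h4,
      ∀ᶠ v : HeightOneSpectrum (𝓞 F) in cofinite, ∀ α β : Multiset ℂ,
        π.1.HasSatakeParamAt v α → π'.1.HasSatakeParamAt v β →
          P.1.HasSatakeParamAt v (satakeTensor α β) := by
  refine Ramakrishnan2000_lemma414_of_JS hJ1 hJ2 hJ3 hGJ π π' hω hω' ?_ hπ
  filter_upwards [hχ, π.1.hasSatakeParamAt_cofinite_holds] with v hv hur
  obtain ⟨α, hα⟩ := hur
  exact ⟨α, χ.valueAtUniformizer v, vAU_ne_zero χ v, hα, hv α hα⟩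

end Lemma414

/-! ### Assembly: Thm. 4.1.2 from Theorem M, Jacquet–Shalika, Gelbart–Jacquet and the dihedral case -/

/-- **Thm. 4.1.2 modulo Theorem M, Jacquet–Shalika (2.1)–(2.3), Gelbart–Jacquet, the central
characters of cuspidal `GL(2)` data and the both-dihedral case.** `Ramakrishnan2000_multiplicityOneSL2`
follows from `Ramakrishnan2000_theoremM`, the three Jacquet–Shalika facts for Borel–Jacquet data, the
Gelbart–Jacquet lift, the Satake shadow of the central character of every cuspidal datum on `GL(2)`
(from the Borel–Jacquet dictionary, `exists_heckeCharacter_prod_satake_of_sSup_irreducible`) and the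
conclusion of Thm. 4.1.2 in the case where both `π` and `π'` admit a non-trivial self-twist — the
architecture of the printed proof (op. cit. §4.1), with Lemma 4.1.4 now supplied by
`Ramakrishnan2000_lemma414_of_JS` (`Ramakrishnan2000_multiplicityOneSL2.of_theoremM` took it as a
hypothesis). [cite: Ramakrishnan2000, §4.1, Thm. 4.1.2 and Lemma 4.1.4] -/
theorem Ramakrishnan2000_multiplicityOneSL2.of_theoremM_of_JS (hM : Ramakrishnan2000_theoremM)
    (hJ1 : JacquetShalika1981_multipliable_partialPairL_repData)
    (hJ2 : JacquetShalika1981_partialPairL_boundary_repData)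
    (hJ3 : JacquetShalika1981_partialPairL_pole_repData)
    (hGJ : GelbartJacquet_adjoint_lift)
    (hω : ∀ (F : Type) [Field F] [NumberField F] (h2 : isCompact_glFiniteIntegralLevel 2 F)
      (π : CuspidalAutomorphicRepData 2 F h2), ∃ Ω : HeckeCharacter F,
        ∀ᶠ v : HeightOneSpectrum (𝓞 F) in cofinite, ∀ α : Multiset ℂ,
          π.1.HasSatakeParamAt v α → Ω.valueAtUniformizer v = α.prod)
    (hdih : ∀ (F : Type) [Field F] [NumberField F] (h2 : isCompact_glFiniteIntegralLevel 2 F)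
      (π π' : CuspidalAutomorphicRepData 2 F h2),
      (∀ᶠ v : HeightOneSpectrum (𝓞 F) in Filter.cofinite, ∃ (α : Multiset ℂ) (c : ℂ), c ≠ 0 ∧
        π.1.HasSatakeParamAt v α ∧ π'.1.HasSatakeParamAt v (α.map (c * ·))) →
      IsSatakeSelfTwist π.1 → IsSatakeSelfTwist π'.1 →
      ∃ χ : HeckeCharacter F, IsSatakeTwistBy π.1 π'.1 χ) :
    Ramakrishnan2000_multiplicityOneSL2 :=
  Ramakrishnan2000_multiplicityOneSL2.of_theoremM hM
    (fun F _ _ h2 _ π π' hLL hπ _ =>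
      Ramakrishnan2000_lemma414_of_JS hJ1 hJ2 hJ3 hGJ π π' (hω F h2 π) (hω F h2 π') hLL hπ)
    hdih

/-- **The same with the central characters supplied by the Borel–Jacquet dictionary** (the three
leaves `AutomorphicRepsGL.exists_isAssociatedL2`, `hasSatakeParamAt_iff_L2`,
`AutomorphicRepsGL.stable_cuspidal_eq_sSup_irreducible` at rank `2`): what separates
`Ramakrishnan2000_multiplicityOneSL2_holds` from the tree is exactly `Ramakrishnan2000_theoremM`, the
Jacquet–Shalika facts (2.1)–(2.3) for Borel–Jacquet data, the Gelbart–Jacquet lift, these leaves,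
and the both-dihedral case of the printed proof. [cite: Ramakrishnan2000, §4.1, Thm. 4.1.2 and Lemma 4.1.4] -/
theorem Ramakrishnan2000_multiplicityOneSL2.of_theoremM_of_JS_of_leaves (hM : Ramakrishnan2000_theoremM)
    (hJ1 : JacquetShalika1981_multipliable_partialPairL_repData)
    (hJ2 : JacquetShalika1981_partialPairL_boundary_repData)
    (hJ3 : JacquetShalika1981_partialPairL_pole_repData)
    (hGJ : GelbartJacquet_adjoint_lift)
    (hAss : ∀ (F : Type) [Field F] [NumberField F] (h2 : isCompact_glFiniteIntegralLevel 2 F)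
      (μ : Measure (gl 2 F).automorphicQuotient) [(gl 2 F).IsAutomorphicMeasure μ],
      AutomorphicRepsGL.exists_isAssociatedL2 h2 μ)
    (hL2 : ∀ (F : Type) [Field F] [NumberField F] (h2 : isCompact_glFiniteIntegralLevel 2 F)
      (μ : Measure (gl 2 F).automorphicQuotient) [(gl 2 F).IsAutomorphicMeasure μ],
      hasSatakeParamAt_iff_L2 h2 μ)
    (hss : ∀ (F : Type) [Field F] [NumberField F] (h2 : isCompact_glFiniteIntegralLevel 2 F),
      AutomorphicRepsGL.stable_cuspidal_eq_sSup_irreducible h2)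
    (hdih : ∀ (F : Type) [Field F] [NumberField F] (h2 : isCompact_glFiniteIntegralLevel 2 F)
      (π π' : CuspidalAutomorphicRepData 2 F h2),
      (∀ᶠ v : HeightOneSpectrum (𝓞 F) in Filter.cofinite, ∃ (α : Multiset ℂ) (c : ℂ), c ≠ 0 ∧
        π.1.HasSatakeParamAt v α ∧ π'.1.HasSatakeParamAt v (α.map (c * ·))) →
      IsSatakeSelfTwist π.1 → IsSatakeSelfTwist π'.1 →
      ∃ χ : HeckeCharacter F, IsSatakeTwistBy π.1 π'.1 χ) :
    Ramakrishnan2000_multiplicityOneSL2 :=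
  Ramakrishnan2000_multiplicityOneSL2.of_theoremM hM
    (fun F _ _ h2 _ π π' hLL hπ _ =>
      Ramakrishnan2000_lemma414_of_JS_of_sSup_irreducible hJ1 hJ2 hJ3 hGJ (hAss F h2) (hL2 F h2)
        (hss F h2) π π' hLL hπ)
    hdih

end Literature.NumberTheory.Automorphic

end
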